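import Literature.RepresentationTheory.KonnoKonno2007.JunctionSwapSymmetry
import Literature.RepresentationTheory.KonnoKonno2007.JunctionHyperbolicFockMatrix
import Literature.Analysis.SegalBargmann.SchwartzTorusIdentification
import HarnessLib

/-!
# The swap `V ↔ W` on the Bargmann side, and the W-side hyperbolic family

Literature reproduction (kernel, `[folklore]`; conventions of Folland 1989 §1.7 and of the tree's
Segal–Bargmann files).  Companion of `JunctionSwapSymmetry` (the coordinate swap
`swapS : 𝓢(ℝ^{DPIdx P Q R S}) ≃L 𝓢(ℝ^{DPIdx R S P Q})`, AX2-K3) and of `JunctionHyperbolicFockMatrix`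
(the Fock matrix of the V-side hyperbolic generator through the frame).

## Part A — relabelling variables (namespace `Literature.Analysis.SegalBargmann`)

For a bijection `e : σ ≃ τ`:
* `binv_rename : B⁻¹ (rename e F) = rename e (B⁻¹ F)` — the inverse Bargmann symbol map commutes with
  relabelling (from `rename e (vac σ) = vac τ` and `rename e ∘ Z_j^* = Z_{e j}^* ∘ rename e`);
* `relabelCLE e : ℝ^σ ≃L ℝ^τ`, `y ↦ y ∘ e⁻¹`, and the transport formulas
  `schwartzTransport (relabelCLE e) (hermiteSchwartzPi p) = hermiteSchwartzPi (rename e p)`,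
  `… (binvPi F) = binvPi (rename e F)`, `… (hermitePi α) = hermitePi (α.equivMapDomain e)`
  (`rename e (herm α) = herm (α.equivMapDomain e)`).

## Part B — the junction (namespace `…KonnoKonno2007.RealDualPair`)

* `swapCLE P Q R S = relabelCLE (swapIdx P Q R S)` (`rfl`), hence `swapS_hermiteSchwartzPi`, `swapS_binvPi`,
  `swapS_symm_binvPi`, `swapS_hermitePi`: **the swap acts on the Fock side by relabelling the variables**
  `z_{(p,r)} ↔ z_{(r,p)}`, … .
* `rename_hypPairSymb`: relabelling the plane symbols `π z_k z_{k'} + π⁻¹ ∂_k ∂_{k'}`.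
* **The W-side hyperbolic family** `hypOpW P Q r₀ s₀ t` on `𝓢(ℝ^{DPIdx P Q R S})` (`r₀ : R`, `s₀ : S`): the swap
  transport `swapS R S P Q ∘ hypOp P Q r₀ s₀ t ∘ (swapS R S P Q)⁻¹` of the V-side family of the swapped pair
  (`hypOpW_eq_opTransport`), with `hypOpW_zero`, `hypOpW_add`, continuity, its generator `hypOpWGen` on all of
  `𝓢` (`tendsto_hypOpW_sub_div(_ofReal/_at)`, scalar cocycles, `hasDerivAt_apply_hypOpW`, `contDiff_apply_hypOpW` —
  the W-side mirror of `JunctionHyperbolicDerivative`), the Fock matrix `hypOpWGen_binvPi_frame`, and its explicit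
  Fock slope
  **`t⁻¹ (hypOpW t (B⁻¹F) − B⁻¹F) → B⁻¹ (i (Σ_q (π z_{(q,r₀)} z_{(q,s₀)} + π⁻¹ ∂∂) − Σ_p (π z_{(p,r₀)} z_{(p,s₀)} + π⁻¹ ∂∂)) F)`**
  (`tendsto_hypOpW_binvPi_sub_div_frame`): the W-side planes are `(p, r₀) | (p, s₀)` (`λ = −π⁻¹`) and
  `(q, r₀) | (q, s₀)` (`λ = +π⁻¹`); for a definite `V` (`Q = ∅`) only the `−π⁻¹` planes occur.

No records, no axioms beyond the standard trio; nothing of print is asserted (the Folland / Konno–Konno loci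
are conventions only).
-/

open MvPolynomial Complex Filter Topology
open scoped Real ContDiff
open Literature.Analysis.SegalBargmann Literature.Analysis.Distribution

noncomputable section

namespace Literature.Analysis.SegalBargmann

/-! ## Part A — relabelling variables by a bijection -/

section Rename

variable {σ τ : Type*} [Fintype σ] [Fintype τ] (e : σ ≃ τ)

/-- the Gaussian is permutation invariant: `gauss (x ∘ e) = gauss x`. [folklore] -/
theorem gauss_comp_equiv (x : τ → ℝ) : gauss (x ∘ e) = gauss x := by
  simp only [gauss, Function.comp_apply]
  rw [e.sum_comp (fun j => ((x j : ℝ) : ℂ) ^ 2)]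

/-- relabelling the variables of a Hermite-type function: `hermiteFun p (x ∘ e) = hermiteFun (rename e p) x`.
[folklore] -/
theorem hermiteFun_comp_equiv (p : MvPolynomial σ ℂ) (x : τ → ℝ) :
    hermiteFun p (x ∘ e) = hermiteFun (rename e p) x := by
  rw [hermiteFun, hermiteFun, eval_rename, gauss_comp_equiv]
  rfl

/-- the vacuum symbol relabelled is the vacuum symbol (same number of variables). [folklore] -/
theorem rename_vac : rename e (vac σ) = vac τ := by
  rw [vac, vac, rename_C, vacCoef, vacCoef, Fintype.card_congr e]

omit [Fintype σ] [Fintype τ] in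
/-- relabelling commutes with the creation symbols: `rename e (Z_j^* G) = Z_{e j}^* (rename e G)`. [folklore] -/
theorem rename_opZs (j : σ) (G : MvPolynomial σ ℂ) : rename e (opZs j G) = opZs (e j) (rename e G) := by
  rw [opZs_apply, opZs_apply, map_sub, map_smul, map_smul, map_mul, rename_X, pderiv_rename e.injective]

/-- **`B⁻¹` commutes with relabelling the variables by a bijection**: `binv (rename e F) = rename e (binv F)`.
[folklore] -/
theorem binv_rename [DecidableEq σ] [DecidableEq τ] (F : MvPolynomial σ ℂ) :
    binv (rename e F) = rename e (binv F) := by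
  induction F using MvPolynomial.induction_on with
  | C a => rw [rename_C, binv_C, binv_C, map_smul, rename_vac]
  | add p q hp hq => rw [map_add, map_add, hp, hq, ← map_add, ← map_add]
  | mul_X p j hp => rw [map_mul, rename_X, mul_comm, mul_comm p, binv_X_mul, binv_X_mul, hp, rename_opZs]

/-- the Hermite normalisation is invariant under relabelling. [folklore] -/
theorem hcoef_equivMapDomain (α : σ →₀ ℕ) : hcoef (α.equivMapDomain e) = hcoef α := by
  simp only [hcoef, mdeg, mfact, Finsupp.equivMapDomain_apply]
  rw [e.symm.sum_comp (fun i => α i), e.symm.prod_comp (fun i => (α i).factorial)]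

/-- **relabelling a Hermite symbol**: `rename e (herm α) = herm (α ∘ e⁻¹)`. [folklore] -/
theorem rename_herm [DecidableEq σ] [DecidableEq τ] (α : σ →₀ ℕ) :
    rename e (herm α) = herm (α.equivMapDomain e) := by
  rw [herm_eq, herm_eq, map_smul, ← binv_rename, rename_monomial, hcoef_equivMapDomain,
    Finsupp.equivMapDomain_eq_mapDomain]

/-- the coordinate relabelling `y ↦ y ∘ e⁻¹ : ℝ^σ ≃L ℝ^τ`. [folklore] -/
abbrev relabelCLE : (σ → ℝ) ≃L[ℝ] (τ → ℝ) := (LinearEquiv.funCongrLeft ℝ ℝ e.symm).toContinuousLinearEquiv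

omit [Fintype τ] in
/-- `relabelCLE e y = y ∘ e⁻¹`. [folklore] -/
@[simp] theorem relabelCLE_apply (y : σ → ℝ) (j : τ) : relabelCLE e y j = y (e.symm j) := rfl

omit [Fintype τ] in
/-- `(relabelCLE e)⁻¹ x = x ∘ e`. [folklore] -/
@[simp] theorem relabelCLE_symm_apply (x : τ → ℝ) (i : σ) : (relabelCLE e).symm x i = x (e i) := rfl

/-- **transport of the Hermite span along a relabelling**:
`(f ↦ f ∘ e^*) (p e^{−π|·|²}) = (rename e p) e^{−π|·|²}`. [folklore] -/
theorem schwartzTransport_relabelCLE_hermiteSchwartzPi (p : MvPolynomial σ ℂ) :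
    schwartzTransport (relabelCLE e) (hermiteSchwartzPi p) = hermiteSchwartzPi (rename e p) := by
  ext x
  rw [schwartzTransport_apply, hermiteSchwartzPi_apply, hermiteSchwartzPi_apply, ← hermiteFun_comp_equiv]
  rfl

/-- **transport of `B⁻¹F` along a relabelling**: `schwartzTransport (relabelCLE e) (binvPi F) = binvPi (rename e F)`.
[folklore] -/
theorem schwartzTransport_relabelCLE_binvPi [DecidableEq σ] [DecidableEq τ] (F : MvPolynomial σ ℂ) :
    schwartzTransport (relabelCLE e) (binvPi F) = binvPi (rename e F) := by
  rw [binvPi_def, schwartzTransport_relabelCLE_hermiteSchwartzPi, ← binv_rename, ← binvPi_def]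

/-- … and backwards: `(schwartzTransport (relabelCLE e))⁻¹ (binvPi F) = binvPi (rename e⁻¹ F)`. [folklore] -/
theorem schwartzTransport_relabelCLE_symm_binvPi [DecidableEq σ] [DecidableEq τ] (F : MvPolynomial τ ℂ) :
    (schwartzTransport (relabelCLE e)).symm (binvPi F) = binvPi (rename e.symm F) := by
  apply (schwartzTransport (relabelCLE e)).injective
  rw [ContinuousLinearEquiv.apply_symm_apply, schwartzTransport_relabelCLE_binvPi, rename_rename,
    Equiv.self_comp_symm, rename_id_apply]

/-- **transport of the Hermite functions along a relabelling**:
`schwartzTransport (relabelCLE e) (hermitePi α) = hermitePi (α ∘ e⁻¹)`. [folklore] -/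
theorem schwartzTransport_relabelCLE_hermitePi [DecidableEq σ] [DecidableEq τ] (α : σ →₀ ℕ) :
    schwartzTransport (relabelCLE e) (hermitePi α) = hermitePi (α.equivMapDomain e) := by
  rw [hermitePi, hermitePi, ← rename_herm]
  exact schwartzTransport_relabelCLE_hermiteSchwartzPi e (herm α)

end Rename

end Literature.Analysis.SegalBargmann

namespace Literature.RepresentationTheory.KonnoKonno2007

namespace RealDualPair

/-- `𝓢(ℝ^σ)` (file-local notation). -/
local notation "SR" σ => SchwartzMap (σ → ℝ) ℂ

/-! ## Part B — the swap on the Bargmann side -/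

section Swap

variable {P Q R S : Type*} [Fintype P] [Fintype Q] [Fintype R] [Fintype S]

/-- the swap's coordinate map is the relabelling by `swapIdx`. [folklore] -/
theorem swapCLE_eq_relabelCLE : swapCLE P Q R S = relabelCLE (swapIdx P Q R S) := rfl

/-- **`swapS` relabels the Hermite span**: `swapS (p e^{−π|·|²}) = (rename σ p) e^{−π|·|²}`. [folklore] -/
theorem swapS_hermiteSchwartzPi (p : MvPolynomial (DPIdx P Q R S) ℂ) :
    swapS P Q R S (hermiteSchwartzPi p) = hermiteSchwartzPi (rename (swapIdx P Q R S) p) :=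
  schwartzTransport_relabelCLE_hermiteSchwartzPi (swapIdx P Q R S) p

variable [DecidableEq P] [DecidableEq Q] [DecidableEq R] [DecidableEq S]

/-- **`swapS (B⁻¹F) = B⁻¹ (rename σ F)`**: on the Fock side the swap `V ↔ W` is the relabelling
`z_{(p,r)} ↦ z_{(r,p)}`, `z_{(q,s)} ↦ z_{(s,q)}`, `z_{(p,s)} ↦ z_{(s,p)}`, `z_{(q,r)} ↦ z_{(r,q)}`. [folklore] -/
theorem swapS_binvPi (F : MvPolynomial (DPIdx P Q R S) ℂ) :
    swapS P Q R S (binvPi F) = binvPi (rename (swapIdx P Q R S) F) :=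
  schwartzTransport_relabelCLE_binvPi (swapIdx P Q R S) F

/-- `swapS⁻¹ (B⁻¹F) = B⁻¹ (rename σ' F)`, `σ'` the swap of the swapped pair. [folklore] -/
theorem swapS_symm_binvPi (F : MvPolynomial (DPIdx R S P Q) ℂ) :
    (swapS P Q R S).symm (binvPi F) = binvPi (rename (swapIdx R S P Q) F) := by
  rw [← swapIdx_symm]
  exact schwartzTransport_relabelCLE_symm_binvPi (swapIdx P Q R S) F

/-- **`swapS` permutes the Hermite basis**: `swapS (h_α) = h_{α ∘ σ⁻¹}`. [folklore] -/
theorem swapS_hermitePi (α : DPIdx P Q R S →₀ ℕ) :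
    swapS P Q R S (hermitePi α) = hermitePi (α.equivMapDomain (swapIdx P Q R S)) :=
  schwartzTransport_relabelCLE_hermitePi (swapIdx P Q R S) α

omit [Fintype P] [Fintype Q] [Fintype R] [Fintype S] [DecidableEq P] [DecidableEq Q] [DecidableEq R]
  [DecidableEq S] in
/-- relabelling the plane symbols: `rename f (π z_k z_{k'} F + π⁻¹ ∂_k∂_{k'} F) = (same at f k, f k') (rename f F)`
for `f` injective. [folklore] -/
theorem rename_hypPairSymb {σ τ : Type*} {f : σ → τ} (hf : Function.Injective f) (k k' : σ)
    (F : MvPolynomial σ ℂ) :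
    rename f (hypPairSymb k k' F) = hypPairSymb (f k) (f k') (rename f F) := by
  simp only [hypPairSymb, map_add, map_smul, map_mul, rename_X, pderiv_rename hf]

end Swap

/-! ## Part B′ — the W-side hyperbolic family -/

section HypW

variable (P Q : Type*) [Fintype P] [DecidableEq P] [Fintype Q] [DecidableEq Q]
  {R S : Type*} [Fintype R] [DecidableEq R] [Fintype S] [DecidableEq S] (r₀ : R) (s₀ : S)

/-- **The W-side hyperbolic family** through the planes `(·, r₀) | (·, s₀)` of `ℝ^{DPIdx P Q R S}`:
the swap transport `swapS ∘ hypOp ∘ swapS⁻¹` of the V-side hyperbolic family `hypOp P Q r₀ s₀` of the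
SWAPPED pair `(R, S, P, Q)`. [folklore] -/
def hypOpW (t : ℝ) : (SR (DPIdx P Q R S)) →L[ℂ] SR (DPIdx P Q R S) :=
  ((swapS R S P Q : (SR (DPIdx R S P Q)) ≃L[ℂ] SR (DPIdx P Q R S)) : (SR (DPIdx R S P Q)) →L[ℂ] SR (DPIdx P Q R S)).comp
    ((hypOp P Q r₀ s₀ t).comp
      (((swapS R S P Q).symm : (SR (DPIdx P Q R S)) ≃L[ℂ] SR (DPIdx R S P Q)) :
        (SR (DPIdx P Q R S)) →L[ℂ] SR (DPIdx R S P Q)))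

/-- `hypOpW t f = swapS (hypOp t (swapS⁻¹ f))`. [folklore] -/
@[simp] theorem hypOpW_apply (t : ℝ) (f : SR (DPIdx P Q R S)) :
    hypOpW P Q r₀ s₀ t f = swapS R S P Q (hypOp P Q r₀ s₀ t ((swapS R S P Q).symm f)) := rfl

/-- `hypOpW t` is the `opTransport` along `swapCLE` of `hypOp t` (the currency of `JunctionSwapSymmetry`:
`liftsTo_opTransport_swap`). [folklore] -/
theorem hypOpW_eq_opTransport (t : ℝ) :
    ((hypOpW P Q r₀ s₀ t : (SR (DPIdx P Q R S)) →L[ℂ] SR (DPIdx P Q R S)) :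
        (SR (DPIdx P Q R S)) →ₗ[ℂ] SR (DPIdx P Q R S)) =
      opTransport (swapCLE R S P Q)
        ((hypOp P Q r₀ s₀ t : (SR (DPIdx R S P Q)) →L[ℂ] SR (DPIdx R S P Q)) :
          (SR (DPIdx R S P Q)) →ₗ[ℂ] SR (DPIdx R S P Q)) :=
  LinearMap.ext fun _ => rfl

/-- `hypOpW 0 = id`. [folklore] -/
theorem hypOpW_zero : hypOpW P Q r₀ s₀ 0 = ContinuousLinearMap.id ℂ (SR (DPIdx P Q R S)) := by
  refine ContinuousLinearMap.ext fun f => ?_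
  rw [hypOpW_apply, hypOp_zero, ContinuousLinearMap.id_apply, ContinuousLinearEquiv.apply_symm_apply,
    ContinuousLinearMap.id_apply]

/-- group law `hypOpW (s + t) = hypOpW s ∘ hypOpW t`. [folklore] -/
theorem hypOpW_add (s t : ℝ) :
    hypOpW P Q r₀ s₀ (s + t) = (hypOpW P Q r₀ s₀ s).comp (hypOpW P Q r₀ s₀ t) := by
  refine ContinuousLinearMap.ext fun f => ?_
  rw [ContinuousLinearMap.comp_apply, hypOpW_apply, hypOpW_apply, hypOpW_apply, hypOp_add,
    ContinuousLinearMap.comp_apply, ContinuousLinearEquiv.symm_apply_apply]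

/-- pointwise group law. [folklore] -/
theorem hypOpW_add_apply (s t : ℝ) (f : SR (DPIdx P Q R S)) :
    hypOpW P Q r₀ s₀ (s + t) f = hypOpW P Q r₀ s₀ s (hypOpW P Q r₀ s₀ t f) := by
  rw [hypOpW_add, ContinuousLinearMap.comp_apply]

/-- joint continuity of `(t, f) ↦ hypOpW t f`. [folklore] -/
theorem continuous_hypOpW_uncurry :
    Continuous fun x : ℝ × SR (DPIdx P Q R S) => hypOpW P Q r₀ s₀ x.1 x.2 := by
  have h1 : Continuous fun x : ℝ × SR (DPIdx P Q R S) => (x.1, (swapS R S P Q).symm x.2) :=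
    continuous_fst.prodMk ((swapS R S P Q).symm.continuous.comp continuous_snd)
  have h2 := (swapS R S P Q).continuous.comp ((continuous_hypOp_uncurry P Q r₀ s₀).comp h1)
  simp only [Function.comp_def] at h2
  simpa only [hypOpW_apply] using h2

/-- continuity of `t ↦ hypOpW t f`. [folklore] -/
theorem continuous_hypOpW_apply (f : SR (DPIdx P Q R S)) : Continuous fun t : ℝ => hypOpW P Q r₀ s₀ t f :=
  (continuous_hypOpW_uncurry P Q r₀ s₀).uncurry_right f

omit [Fintype P] [DecidableEq P] [Fintype Q] [DecidableEq Q] [Fintype R] [DecidableEq R] [Fintype S]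
  [DecidableEq S] in
/-- `swapIdx` of the swapped pair undoes `swapIdx` (pointwise form of `swapIdx_symm`). [folklore] -/
theorem swapIdx_swapIdx_apply (i : DPIdx P Q R S) : swapIdx R S P Q (swapIdx P Q R S i) = i := by
  rcases i with ((⟨p, r⟩ | ⟨q, s⟩) | (⟨p, s⟩ | ⟨q, r⟩)) <;> rfl

omit [Fintype P] [DecidableEq P] [Fintype Q] [DecidableEq Q] [Fintype R] [DecidableEq R] [Fintype S]
  [DecidableEq S] in
/-- `swapIdx R S P Q ∘ swapIdx P Q R S = id`. [folklore] -/
theorem swapIdx_comp_swapIdx : (⇑(swapIdx R S P Q) ∘ ⇑(swapIdx P Q R S)) = id :=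
  _root_.funext fun i => swapIdx_swapIdx_apply P Q i

/-- `swapS` undoes `swapS⁻¹` on `B⁻¹F` through the relabellings (bookkeeping). [folklore] -/
theorem swapS_binvPi_rename_swapIdx (F : MvPolynomial (DPIdx P Q R S) ℂ) :
    swapS R S P Q (binvPi (rename (swapIdx P Q R S) F)) = binvPi F := by
  rw [swapS_binvPi, rename_rename, swapIdx_comp_swapIdx, rename_id_apply]

/-- **The generator of the W-side hyperbolic family** on all of `𝓢` (real scalars): the swap transport
`swapS ∘ hypOpGen ∘ swapS⁻¹` of the V-side generator of the swapped pair. [folklore] -/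
def hypOpWGen : (SR (DPIdx P Q R S)) →L[ℝ] SR (DPIdx P Q R S) :=
  (((swapS R S P Q : (SR (DPIdx R S P Q)) ≃L[ℂ] SR (DPIdx P Q R S)) :
      (SR (DPIdx R S P Q)) →L[ℂ] SR (DPIdx P Q R S)).restrictScalars ℝ).comp
    ((hypOpGen P Q r₀ s₀).comp
      ((((swapS R S P Q).symm : (SR (DPIdx P Q R S)) ≃L[ℂ] SR (DPIdx R S P Q)) :
        (SR (DPIdx P Q R S)) →L[ℂ] SR (DPIdx R S P Q)).restrictScalars ℝ))

/-- `hypOpWGen f = swapS (hypOpGen (swapS⁻¹ f))`. [folklore] -/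
@[simp] theorem hypOpWGen_apply (f : SR (DPIdx P Q R S)) :
    hypOpWGen P Q r₀ s₀ f = swapS R S P Q (hypOpGen P Q r₀ s₀ ((swapS R S P Q).symm f)) := rfl

/-- **`hypOpW` differentiated at `0` in the Schwartz topology** (real scalars):
`t⁻¹ • (hypOpW t f − f) ⟶ hypOpWGen f` along `𝓝[≠] 0`. [cite: Folland1989, (4.24)] -/
theorem tendsto_hypOpW_sub_div (f : SR (DPIdx P Q R S)) :
    Tendsto (fun t : ℝ => t⁻¹ • (hypOpW P Q r₀ s₀ t f - f)) (𝓝[≠] 0) (𝓝 (hypOpWGen P Q r₀ s₀ f)) := by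
  have h := ((swapS R S P Q).continuous.tendsto _).comp
    (tendsto_hypOp_sub_div P Q r₀ s₀ ((swapS R S P Q).symm f))
  rw [hypOpWGen_apply]
  refine h.congr fun t => ?_
  have e1 : swapS R S P Q (t⁻¹ • (hypOp P Q r₀ s₀ t ((swapS R S P Q).symm f) - (swapS R S P Q).symm f)) =
      t⁻¹ • (hypOpW P Q r₀ s₀ t f - f) := by
    rw [← ContinuousLinearEquiv.coe_coe (swapS R S P Q), ContinuousLinearMap.map_smul_of_tower, map_sub,
      ContinuousLinearEquiv.coe_coe, hypOpW_apply, ContinuousLinearEquiv.apply_symm_apply]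
  exact e1

/-- … (complex scalars): `((t:ℝ):ℂ)⁻¹ • (hypOpW t f − f) ⟶ hypOpWGen f`. [cite: Folland1989, (4.24)] -/
theorem tendsto_hypOpW_sub_div_ofReal (f : SR (DPIdx P Q R S)) :
    Tendsto (fun t : ℝ => ((t : ℝ) : ℂ)⁻¹ • (hypOpW P Q r₀ s₀ t f - f)) (𝓝[≠] 0)
      (𝓝 (hypOpWGen P Q r₀ s₀ f)) :=
  Literature.Analysis.Distribution.tendsto_ofReal_inv_smul_iff.2 (tendsto_hypOpW_sub_div P Q r₀ s₀ f)

/-- **`hypOpW` differentiated at every base point** (real scalars):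
`t⁻¹ • (hypOpW (t₀ + t) f − hypOpW t₀ f) ⟶ hypOpWGen (hypOpW t₀ f)`. [cite: Folland1989, (4.24)] -/
theorem tendsto_hypOpW_sub_div_at (f : SR (DPIdx P Q R S)) (t₀ : ℝ) :
    Tendsto (fun t : ℝ => t⁻¹ • (hypOpW P Q r₀ s₀ (t₀ + t) f - hypOpW P Q r₀ s₀ t₀ f)) (𝓝[≠] 0)
      (𝓝 (hypOpWGen P Q r₀ s₀ (hypOpW P Q r₀ s₀ t₀ f))) := by
  refine (tendsto_hypOpW_sub_div P Q r₀ s₀ (hypOpW P Q r₀ s₀ t₀ f)).congr fun t => ?_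
  rw [add_comm t₀ t, hypOpW_add_apply]

/-- the generator commutes with the family: `hypOpWGen (hypOpW s f) = hypOpW s (hypOpWGen f)`. [folklore] -/
theorem hypOpWGen_hypOpW_comm (t : ℝ) (f : SR (DPIdx P Q R S)) :
    hypOpWGen P Q r₀ s₀ (hypOpW P Q r₀ s₀ t f) = hypOpW P Q r₀ s₀ t (hypOpWGen P Q r₀ s₀ f) := by
  rw [hypOpWGen_apply, hypOpW_apply, ContinuousLinearEquiv.symm_apply_apply, hypOpGen_hypOp_comm, hypOpW_apply,
    hypOpWGen_apply, ContinuousLinearEquiv.symm_apply_apply]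

/-- **with a scalar cocycle** `c` (`c 0 = 1`, `c'(0) = κ`): `t⁻¹ • (c t • hypOpW t f − f) ⟶ κ • f + hypOpWGen f`.
[folklore] -/
theorem tendsto_smul_hypOpW_sub_div {c : ℝ → ℂ} {κ : ℂ} (hc0 : c 0 = 1) (hc : HasDerivAt c κ 0)
    (f : SR (DPIdx P Q R S)) :
    Tendsto (fun t : ℝ => t⁻¹ • (c t • hypOpW P Q r₀ s₀ t f - f)) (𝓝[≠] 0)
      (𝓝 (κ • f + hypOpWGen P Q r₀ s₀ f)) :=
  tendsto_smul_sub_div hc0 hc (tendsto_hypOpW_sub_div P Q r₀ s₀ f)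

/-- … complex scalars. [folklore] -/
theorem tendsto_smul_hypOpW_sub_div_ofReal {c : ℝ → ℂ} {κ : ℂ} (hc0 : c 0 = 1) (hc : HasDerivAt c κ 0)
    (f : SR (DPIdx P Q R S)) :
    Tendsto (fun t : ℝ => ((t : ℝ) : ℂ)⁻¹ • (c t • hypOpW P Q r₀ s₀ t f - f)) (𝓝[≠] 0)
      (𝓝 (κ • f + hypOpWGen P Q r₀ s₀ f)) :=
  tendsto_ofReal_inv_smul_iff.2 (tendsto_smul_hypOpW_sub_div P Q r₀ s₀ hc0 hc f)

/-- **Scalar coefficients**: for every real continuous linear `T : 𝓢 → G`, `s ↦ T (hypOpW s f)` has derivative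
`T (hypOpWGen (hypOpW t₀ f))` at `t₀`. [folklore] -/
theorem hasDerivAt_apply_hypOpW {G : Type*} [NormedAddCommGroup G] [NormedSpace ℝ G]
    (T : (SR (DPIdx P Q R S)) →L[ℝ] G) (f : SR (DPIdx P Q R S)) (t₀ : ℝ) :
    HasDerivAt (fun s : ℝ => T (hypOpW P Q r₀ s₀ s f)) (T (hypOpWGen P Q r₀ s₀ (hypOpW P Q r₀ s₀ t₀ f))) t₀ := by
  rw [hasDerivAt_iff_tendsto_slope_zero]
  have h := (T.continuous.tendsto _).comp (tendsto_hypOpW_sub_div_at P Q r₀ s₀ f t₀)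
  refine h.congr fun t => ?_
  simp only [Function.comp_apply]
  rw [map_smul, map_sub]

/-- **Scalar coefficients are smooth**: `s ↦ T (hypOpW s f)` is `C^∞`. [folklore] -/
theorem contDiff_apply_hypOpW {G : Type*} [NormedAddCommGroup G] [NormedSpace ℝ G]
    (T : (SR (DPIdx P Q R S)) →L[ℝ] G) (f : SR (DPIdx P Q R S)) :
    ContDiff ℝ ∞ (fun s : ℝ => T (hypOpW P Q r₀ s₀ s f)) :=
  contDiff_infty_apply_of_hasDerivAt_comp (γ := fun s : ℝ => hypOpW P Q r₀ s₀ s f) (N := hypOpWGen P Q r₀ s₀)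
    (fun T' s => hasDerivAt_apply_hypOpW P Q r₀ s₀ T' f s) T

/-- continuity of `s ↦ hypOpWGen (hypOpW s f)`. [folklore] -/
theorem continuous_hypOpWGen_hypOpW (f : SR (DPIdx P Q R S)) :
    Continuous fun s : ℝ => hypOpWGen P Q r₀ s₀ (hypOpW P Q r₀ s₀ s f) :=
  (hypOpWGen P Q r₀ s₀).continuous.comp (continuous_hypOpW_apply P Q r₀ s₀ f)

/-- the swap carries the V-side plane sums of the swapped pair (in the variables `rename σ F`) to the
W-side plane sums in the variables `F`. [folklore] -/
theorem swapS_binvPi_planeSums (F : MvPolynomial (DPIdx P Q R S) ℂ) :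
    swapS R S P Q (binvPi (I • ((∑ q : Q, hypPairSymb (Sum.inr (Sum.inl (r₀, q)))
      (Sum.inl (Sum.inr (s₀, q))) (rename (swapIdx P Q R S) F)) -
      ∑ p : P, hypPairSymb (Sum.inl (Sum.inl (r₀, p))) (Sum.inr (Sum.inr (s₀, p)))
        (rename (swapIdx P Q R S) F)))) =
      binvPi (I • ((∑ q : Q, hypPairSymb (Sum.inr (Sum.inr (q, r₀))) (Sum.inl (Sum.inr (q, s₀))) F) -
        ∑ p : P, hypPairSymb (Sum.inl (Sum.inl (p, r₀))) (Sum.inr (Sum.inl (p, s₀))) F)) := by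
  rw [swapS_binvPi, map_smul, map_sub, map_sum, map_sum]
  simp only [rename_hypPairSymb (swapIdx R S P Q).injective, rename_rename, swapIdx_comp_swapIdx,
    rename_id_apply]
  rfl

/-- **THE FOCK MATRIX OF THE W-SIDE GENERATOR**:
`hypOpWGen (B⁻¹F) = B⁻¹ (i (Σ_q (π z_{(q,r₀)} z_{(q,s₀)} + π⁻¹ ∂_{(q,r₀)} ∂_{(q,s₀)})
  − Σ_p (π z_{(p,r₀)} z_{(p,s₀)} + π⁻¹ ∂_{(p,r₀)} ∂_{(p,s₀)})) F)`: the W-side planes are `(p, r₀) | (p, s₀)`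
with `λ = −π⁻¹` and `(q, r₀) | (q, s₀)` with `λ = +π⁻¹` in the printed form `(i/λ) P + i λ Δ`.
[cite: Folland1989, Prop. (4.39)] -/
theorem hypOpWGen_binvPi_frame (F : MvPolynomial (DPIdx P Q R S) ℂ) :
    hypOpWGen P Q r₀ s₀ (binvPi F) =
      binvPi (I • ((∑ q : Q, hypPairSymb (Sum.inr (Sum.inr (q, r₀))) (Sum.inl (Sum.inr (q, s₀))) F) -
        ∑ p : P, hypPairSymb (Sum.inl (Sum.inl (p, r₀))) (Sum.inr (Sum.inl (p, s₀))) F)) := by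
  rw [hypOpWGen_apply, swapS_symm_binvPi, hypOpGen_binvPi_frame, swapS_binvPi_planeSums]

/-- **THE FOCK SLOPE OF THE W-SIDE HYPERBOLIC FAMILY, EXPLICITLY**:
`((t:ℝ):ℂ)⁻¹ • (hypOpW t (B⁻¹F) − B⁻¹F) ⟶ B⁻¹ (i (Σ_q … − Σ_p …) F)` as `t → 0`, `t ≠ 0`.
[cite: Folland1989, Prop. (4.39)] -/
theorem tendsto_hypOpW_binvPi_sub_div_frame (F : MvPolynomial (DPIdx P Q R S) ℂ) :
    Tendsto (fun t : ℝ => ((t : ℝ) : ℂ)⁻¹ • (hypOpW P Q r₀ s₀ t (binvPi F) - binvPi F)) (𝓝[≠] 0)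
      (𝓝 (binvPi (I • ((∑ q : Q, hypPairSymb (Sum.inr (Sum.inr (q, r₀))) (Sum.inl (Sum.inr (q, s₀))) F) -
        ∑ p : P, hypPairSymb (Sum.inl (Sum.inl (p, r₀))) (Sum.inr (Sum.inl (p, s₀))) F)))) := by
  rw [← hypOpWGen_binvPi_frame]
  exact tendsto_hypOpW_sub_div_ofReal P Q r₀ s₀ (binvPi F)

/-- the same slope with `hypOpW 0 (B⁻¹F)` in place of `B⁻¹F` (the shape of a `𝓝[≠] 0` difference quotient of
the family at `0`). [cite: Folland1989, Prop. (4.39)] -/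
theorem tendsto_hypOpW_binvPi_sub_hypOpW_zero_div_frame (F : MvPolynomial (DPIdx P Q R S) ℂ) :
    Tendsto (fun t : ℝ => ((t : ℝ) : ℂ)⁻¹ • (hypOpW P Q r₀ s₀ t (binvPi F) - hypOpW P Q r₀ s₀ 0 (binvPi F)))
      (𝓝[≠] 0)
      (𝓝 (binvPi (I • ((∑ q : Q, hypPairSymb (Sum.inr (Sum.inr (q, r₀))) (Sum.inl (Sum.inr (q, s₀))) F) -
        ∑ p : P, hypPairSymb (Sum.inl (Sum.inl (p, r₀))) (Sum.inr (Sum.inl (p, s₀))) F)))) := by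
  simp only [hypOpW_zero, ContinuousLinearMap.id_apply]
  exact tendsto_hypOpW_binvPi_sub_div_frame P Q r₀ s₀ F

end HypW

end RealDualPair

end Literature.RepresentationTheory.KonnoKonno2007

end
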